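import Summits.QuantumFields.BalabanUV.Beta.FP.SliceProjectorKernel
import Summits.QuantumFields.BalabanUV.Beta.FP.CoarseCovarianceStripAlias

/-!
# `BalabanUV.Beta.FP.SliceProjectorKernelSymm` — road «FP» (binder row D1), organisation γ, row **GAMMA-3 (d)** part 5∕5 ((K5) of INTENT l.27194,
# «only if cheap» — it was): **SYMMETRY `piC N x y = piC N y x` AND REALITY `conj (piC N x y) = piC N x y`** of the road instance of
# `(1 − Π)_N` on `ℤ^D` — the reflection `k ↦ −k`, `l ↦ −l` of the Bloch data SWAPS the pole-free row and column alias sums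
# (`Ra N a (−k) = Rb N a k`), leaves `𝒩` invariant, hence `S N a b (−k) = S N b a k` (symmetry); conjugation on the REAL zone swaps them too
# (`conj (S N a b k) = S N b a k`, Hermiticity); together the kernel is a REAL SYMMETRIC PROJECTION KERNEL

HONEST FRAMING (cell contract, verbatim): «discharging `BetaPertH` makes Bałaban's UV stability UNCONDITIONAL — a real constructive-QFT
result; it is NOT the continuum limit and NOT the Clay problem.»  HONEST DEPENDENCY (verbatim): «continuum YM on T⁴ ⇐ BetaPertH ∧ nine
spine estimates (0/9 proved); BetaPertH ⇐ (D1) ∧ (D4) ∧ CAP+tail; G-an2-4 gates asym, D1 and NE2/3/4.»  THIS MODULE DISCHARGES NOTHING of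
D1 ∕ BetaPertH: [folklore] reflection bookkeeping of the alias data (`Fin.val_neg`, `2π`-periodicity and evenness of `gsum`, `S₁`, `S_ξ`), the
reindexing `l ↦ −l` of residue sums, and the reflection invariance of Lebesgue measure on the Brillouin zone (`integral_neg_eq_self`); over
`FP/SliceProjectorKernel`.  [our object] data def `negLift` (the `{0,1}`-valued lift of the residue negation); no `def … : Prop`; nothing is cited;
0 sorry.  With part 3∕5's IDEMPOTENCE this makes `piC N` a REAL SYMMETRIC PROJECTION KERNEL (`Πᵀ = Π`, used by the model rows' (W1)↔(W2)
transposition; the road's real kernels may consume `(piC N x y).re`, `ofReal_piC_re`).  NOT HERE: B-jets; ℓ²-completeness.  NOT summit progress;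
NOT hbook, NOT D1, NOT BetaPertH, NOT continuum, NOT Clay.

ABSOLUTE RULE (cell, verbatim): «No internally-minted statement may enter as a cited fact. Every hypothesis is either kernel-proved in this
package or a verbatim quotation of a PUBLISHED theorem with page reference. The manuscript(s) under audit are NOT citable for their own
disputed steps — they are the thing under adjudication; programme-internal (2001/route/tribunal) claims are never citable.»

CONTENT (`D = d+1`, `N ≥ 1`; «fat strip» = `Fat D (rOf D)`):
* [our object] `negLift`; **`aliasPt_neg_neg`** (`k_{−l}(−k)_i = −k_l(k)_i + 2π·m_l(i)`, `m ∈ {0,1}^D`); `gsum_add_two_pi_natMul`∕`gsum_sub_two_pi_natMul`;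
  **`qa_neg_neg`** (`qa(−l,−k) = qb(l,k)`), **`qb_neg_neg`**; `cphase_aliasPt_neg_neg`; `Sxi_neg`, `DeltaXi_neg`, `Delta1_aliasPt_neg_neg`,
  `DeltaXi_shift_neg_neg`, **`ew_neg_neg`**; `sum_neg_index`; **`Ra_neg`**, **`Rb_neg`**; **`Ncal_neg`** (on the fat strip, `CoarseCovarianceStripAlias.neg_mem_Fat` ✓ BY NAME);
  **`S_neg_swap`** (`S N a b (−k) = S N b a k`); `neg_mem_BZ`, **`latticeKernel_reflect_zero`**; **`piC_symm`**.
* §10 `conj_cphase_ofRealVec`, `conj_gsum_ofReal`, `aliasPt_ofRealVec_apply`, **`conj_qa_ofRealVec`** (`conj qa = qb` on the real zone), `conj_qb_ofRealVec`,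
  `conj_ew_ofRealVec`, **`conj_Ra_ofRealVec`**, `conj_Rb_ofRealVec`, **`conj_S_ofRealVec`** (`conj (S N a b k) = S N b a k`, real `k`),
  `conj_latticeKernel_zero`, **`conj_piC`** (Hermiticity), **`conj_piC_eq_self`** (REALITY), `piC_im`, `ofReal_piC_re`.
Unit `b2b-balaban-beta-d1-formalise-leaf-06` (gen 9), road «FP» OWNER GO «THIS SHAPE» journal l.27277 (1) on INTENT l.27194; organisation γ (R-FP-25), row GAMMA-3 (d), under R-FP-33 (b)(c).
-/

noncomputable section

namespace Summit.QuantumFields.BalabanUV.Beta.FP.SliceProjectorKernelSymm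

open Complex Finset MeasureTheory
open scoped BigOperators Real
open Literature.MathematicalPhysics.QuantumFieldTheory.Balaban1983to89
open B4Strip (Strip ofRealVec DeltaXi Delta1 S1 Sxi shift U)
open B4StripCauchy (Fat rOf rOf_le)
open B5Strip145 (Ncal)
open B4ContourShift (BZ phase integrand fourierBox latticeKernel)
open B4Green244 (latticeKernel_congr)
open Beta.FibreInverseDecay (cphase)
open Summit.QuantumFields.BalabanUV.Beta.GAN24.FibreSymbols (gsum)
open Summit.QuantumFields.BalabanUV.Beta.GAN24.AliasDecimate (aliasPt)
open Summit.QuantumFields.BalabanUV.Beta.FP.CoarseCovarianceStripAliasWeights (aliasPt_apply')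
open Summit.QuantumFields.BalabanUV.Beta.FP.SliceProjectorEntries (qa qb ew ew_zero ew_ne qa_mul_qb)
open Summit.QuantumFields.BalabanUV.Beta.FP.SliceProjectorSymbol (S DeltaXi_shift_eq)
open Summit.QuantumFields.BalabanUV.Beta.FP.SliceProjectorBlochChart
open Summit.QuantumFields.BalabanUV.Beta.FP.SliceProjectorBloch
open Summit.QuantumFields.BalabanUV.Beta.FP.SliceProjectorKernel

variable {d : ℕ}

/-! ## §9 SYMMETRY `piC N x y = piC N y x` (the reflection `k ↦ −k`, `l ↦ −l` of the Bloch data swaps the row and column alias sums) -/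

section Symm

variable (N : ℕ) [NeZero N]

/-- [folklore] the lift `m_l ∈ {0,1}^D` of the residue negation: `(−l)_i = N − l_i` for `l_i ≠ 0`, `= 0` for `l_i = 0`. -/
def negLift (l : Fin (d + 1) → Fin N) (i : Fin (d + 1)) : ℕ := if l i = 0 then 0 else 1

/-- [folklore] **THE REFLECTED ALIAS MOMENTUM**: `aliasPt N (−l) (−k) i = −aliasPt N l k i + 2π·m_l(i)`, `m_l(i) ∈ {0,1}`. -/
theorem aliasPt_neg_neg (l : Fin (d + 1) → Fin N) (k : Fin (d + 1) → ℂ) (i : Fin (d + 1)) :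
    aliasPt N (-l) (-k) i = -(aliasPt N l k i) + 2 * π * (negLift N l i : ℂ) := by
  have hN : (N : ℂ) ≠ 0 := Nat.cast_ne_zero.mpr (NeZero.ne N)
  rw [aliasPt_apply', aliasPt_apply', Pi.neg_apply, Pi.neg_apply, Fin.val_neg]
  unfold negLift
  by_cases h : l i = 0
  · simp only [h, if_true, Fin.val_zero, Nat.cast_zero, mul_zero, add_zero]
    field_simp
  · simp only [h, if_false, Nat.cast_one, mul_one]
    have hle : (l i : ℕ) ≤ N := (l i).isLt.le
    rw [Nat.cast_sub hle]
    field_simp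
    ring

/-- [folklore] `gsum` is `2π`-periodic with any natural multiple: `gsum (z + 2π·m) N = gsum z N`. -/
theorem gsum_add_two_pi_natMul (z : ℂ) (m M : ℕ) : gsum (z + 2 * π * (m : ℂ)) M = gsum z M := by
  unfold gsum
  refine Finset.sum_congr rfl fun t _ => ?_
  rw [show I * (z + 2 * π * (m : ℂ)) * (t : ℂ) = I * z * (t : ℂ) + ((m * t : ℕ) : ℂ) * (2 * π * I) by push_cast; ring,
    Complex.exp_add, Complex.exp_nat_mul_two_pi_mul_I, mul_one]

/-- [folklore] … and with any negative natural multiple: `gsum (z − 2π·m) N = gsum z N`. -/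
theorem gsum_sub_two_pi_natMul (z : ℂ) (m M : ℕ) : gsum (z - 2 * π * (m : ℂ)) M = gsum z M := by
  rw [← gsum_add_two_pi_natMul (z - 2 * π * (m : ℂ)) m M, sub_add_cancel]

/-- [folklore] reflection swaps the block-mean alias factors: `qa N (−l) (−k) = qb N l k`. -/
theorem qa_neg_neg (l : Fin (d + 1) → Fin N) (k : Fin (d + 1) → ℂ) : qa N (-l) (-k) = qb N l k := by
  unfold qa qb
  congr 1
  refine Finset.prod_congr rfl fun i _ => ?_
  rw [aliasPt_neg_neg, gsum_add_two_pi_natMul]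

/-- [folklore] … and `qb N (−l) (−k) = qa N l k`. -/
theorem qb_neg_neg (l : Fin (d + 1) → Fin N) (k : Fin (d + 1) → ℂ) : qb N (-l) (-k) = qa N l k := by
  unfold qa qb
  congr 1
  refine Finset.prod_congr rfl fun i _ => ?_
  rw [aliasPt_neg_neg, neg_add, neg_neg, ← sub_eq_add_neg, gsum_sub_two_pi_natMul]

/-- [folklore] the character at the reflected alias momentum: `cphase a (k_{−l}(−k)) = cphase (−a) (k_l(k))`. -/
theorem cphase_aliasPt_neg_neg (a : Fin (d + 1) → ℤ) (l : Fin (d + 1) → Fin N) (k : Fin (d + 1) → ℂ) :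
    cphase a (aliasPt N (-l) (-k)) = cphase (-a) (aliasPt N l k) := by
  unfold cphase
  simp_rw [aliasPt_neg_neg, Pi.neg_apply, Int.cast_neg]
  rw [show (∑ μ, (-aliasPt N l k μ + 2 * π * (negLift N l μ : ℂ)) * (a μ : ℂ))
      = (∑ μ, aliasPt N l k μ * -(a μ : ℂ)) + ((∑ μ, (negLift N l μ : ℤ) * a μ : ℤ) : ℂ) * (2 * π) by
    push_cast; rw [Finset.sum_mul, ← Finset.sum_add_distrib]; exact Finset.sum_congr rfl fun μ _ => by ring]
  rw [mul_add, Complex.exp_add, show I * (((∑ μ, (negLift N l μ : ℤ) * a μ : ℤ) : ℂ) * (2 * π))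
      = ((∑ μ, (negLift N l μ : ℤ) * a μ : ℤ) : ℂ) * (2 * π * I) by ring, Complex.exp_int_mul_two_pi_mul_I, mul_one]

/-- [folklore] `S_ξ` is even. -/
theorem Sxi_neg (n : ℕ) (z : ℂ) : Sxi n (-z) = Sxi n z := by
  unfold Sxi; rw [neg_div, Complex.cos_neg]

omit [NeZero N] in
/-- [folklore] `Δ^ξ` is even: `Δ^ξ(−k) = Δ^ξ(k)`. -/
theorem DeltaXi_neg (k : Fin (d + 1) → ℂ) : DeltaXi N 0 (-k) = DeltaXi N 0 k := by
  unfold DeltaXi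
  simp_rw [Pi.neg_apply, Sxi_neg]

/-- [folklore] `Δ¹` at the reflected alias momentum: `Δ¹(k_{−l}(−k)) = Δ¹(k_l(k))` (`S₁` even and `2π`-periodic). -/
theorem Delta1_aliasPt_neg_neg (l : Fin (d + 1) → Fin N) (k : Fin (d + 1) → ℂ) :
    Delta1 0 (aliasPt N (-l) (-k)) = Delta1 0 (aliasPt N l k) := by
  unfold Delta1
  congr 1
  refine Finset.sum_congr rfl fun μ _ => ?_
  rw [aliasPt_neg_neg]
  unfold negLift
  split_ifs
  · simp only [Nat.cast_zero, mul_zero, add_zero, S1, Complex.cos_neg]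
  · rw [Nat.cast_one, mul_one, B5Strip145Analytic.S1_add_two_pi]
    simp only [S1, Complex.cos_neg]

/-- [folklore] the shifted Laplacian symbol at the reflected data: `Δ^ξ(−k + 2π(−l)) = Δ^ξ(k + 2πl)`. -/
theorem DeltaXi_shift_neg_neg (l : Fin (d + 1) → Fin N) (k : Fin (d + 1) → ℂ) :
    DeltaXi N 0 (shift N (-l) (-k)) = DeltaXi N 0 (shift N l k) := by
  rw [DeltaXi_shift_eq, DeltaXi_shift_eq, Delta1_aliasPt_neg_neg]

/-- [folklore] the regrouping factor is reflection invariant: `e_{−l}(−k) = e_l(k)`. -/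
theorem ew_neg_neg (l : Fin (d + 1) → Fin N) (k : Fin (d + 1) → ℂ) : ew N (-l) (-k) = ew N l k := by
  by_cases hl : l = fun _ => 0
  · subst hl
    rw [show (-(fun _ : Fin (d + 1) => (0 : Fin N))) = fun _ => 0 from funext fun _ => neg_zero, ew_zero, ew_zero]
  · have hl' : (-l) ≠ fun _ => 0 := by
      intro h; apply hl; funext i
      have := congrFun h i; simp only [Pi.neg_apply, neg_eq_zero] at this; exact this
    rw [ew_ne N hl, ew_ne N hl', DeltaXi_neg, DeltaXi_shift_neg_neg]

omit [NeZero N] in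
/-- [folklore] reindexing a sum over the residues by negation. -/
theorem sum_neg_index (F : (Fin (d + 1) → Fin N) → ℂ) : ∑ l : Fin (d + 1) → Fin N, F (-l) = ∑ l, F l :=
  Fintype.sum_equiv (Equiv.neg _) _ _ fun l => by simp

/-- [our object] **REFLECTION SWAPS THE ROW AND COLUMN ALIAS SUMS**: `Ra N a (−k) = Rb N a k`. -/
theorem Ra_neg (a : Fin (d + 1) → ℤ) (k : Fin (d + 1) → ℂ) : Ra N a (-k) = Rb N a k := by
  unfold Ra Rb
  rw [← sum_neg_index N fun l => cphase a (aliasPt N l (-k)) * (qa N l (-k) * ew N l (-k))]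
  refine Finset.sum_congr rfl fun l _ => ?_
  rw [cphase_aliasPt_neg_neg, qa_neg_neg, ew_neg_neg]

/-- [our object] … and `Rb N b (−k) = Ra N b k`. -/
theorem Rb_neg (b : Fin (d + 1) → ℤ) (k : Fin (d + 1) → ℂ) : Rb N b (-k) = Ra N b k := by
  unfold Ra Rb
  rw [← sum_neg_index N fun l => cphase (-b) (aliasPt N l (-k)) * (qb N l (-k) * ew N l (-k))]
  refine Finset.sum_congr rfl fun l _ => ?_
  rw [cphase_aliasPt_neg_neg, neg_neg, qb_neg_neg, ew_neg_neg]

/-- [folklore] the regrouped denominator is even on the fat strip: `𝒩(−k) = 𝒩(k)`. -/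
theorem Ncal_neg {k : Fin (d + 1) → ℂ} (hk : k ∈ Fat (d + 1) (rOf (d + 1))) : Ncal N (-k) = Ncal N k := by
  rw [Ncal_eq_sum_U_mul_ew_sq, Ncal_eq_sum_U_mul_ew_sq, ← sum_neg_index N fun l => U N l (-k) * ew N l (-k) ^ 2]
  refine Finset.sum_congr rfl fun l _ => ?_
  rw [← qa_mul_qb N (rOf_le (d + 1)) (Summit.QuantumFields.BalabanUV.Beta.FP.CoarseCovarianceStripAlias.neg_mem_Fat hk),
    ← qa_mul_qb N (rOf_le (d + 1)) hk, qa_neg_neg, qb_neg_neg, ew_neg_neg]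
  ring

/-- [our object] **THE SYMBOL IDENTITY OF THE SYMMETRY**: on the fat strip, `S N a b (−k) = S N b a k`. -/
theorem S_neg_swap {k : Fin (d + 1) → ℂ} (hk : k ∈ Fat (d + 1) (rOf (d + 1))) (a b : Fin (d + 1) → ℤ) :
    S N a b (-k) = S N b a k := by
  rw [S_eq_Ra_mul_Rb, S_eq_Ra_mul_Rb, Ra_neg, Rb_neg, Ncal_neg N hk]
  ring

/-- [folklore] the real Brillouin zone is reflection symmetric. -/
theorem neg_mem_BZ {p : Fin (d + 1) → ℝ} (hp : p ∈ BZ (d + 1)) : -p ∈ BZ (d + 1) := by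
  simp only [BZ, Set.mem_Icc, Pi.le_def, Pi.neg_apply] at hp ⊢
  exact ⟨fun i => by linarith [hp.2 i], fun i => by linarith [hp.1 i]⟩

/-- [folklore] **THE LATTICE KERNEL AT THE ORIGIN IS REFLECTION INVARIANT**: `latticeKernel (G ∘ (−·)) 0 = latticeKernel G 0`. -/
theorem latticeKernel_reflect_zero (G : (Fin (d + 1) → ℂ) → ℂ) : latticeKernel (fun k => G (-k)) 0 = latticeKernel G 0 := by
  unfold latticeKernel fourierBox
  congr 1
  have hI : ∀ F : (Fin (d + 1) → ℂ) → ℂ, integrand F 0 = fun p => F (ofRealVec p) := by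
    intro F; funext p; simp [integrand, phase]
  have hBZ : MeasurableSet (BZ (d + 1)) := measurableSet_Icc
  rw [hI, hI, ← integral_indicator hBZ, ← integral_indicator hBZ]
  have hneg : ∀ p : Fin (d + 1) → ℝ, ofRealVec (-p) = -ofRealVec p := fun p => funext fun i => by simp [ofRealVec]
  have hind : (BZ (d + 1)).indicator (fun p : Fin (d + 1) → ℝ => G (-ofRealVec p))
      = fun p => (BZ (d + 1)).indicator (fun p : Fin (d + 1) → ℝ => G (ofRealVec p)) (-p) := by
    funext p
    by_cases hp : p ∈ BZ (d + 1)
    · rw [Set.indicator_of_mem hp, Set.indicator_of_mem (neg_mem_BZ hp), hneg]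
    · have hp' : -p ∉ BZ (d + 1) := fun h => hp (by simpa using neg_mem_BZ h)
      rw [Set.indicator_of_notMem hp, Set.indicator_of_notMem hp']
  show ∫ p, (BZ (d + 1)).indicator (fun p => G (-ofRealVec p)) p = ∫ p, (BZ (d + 1)).indicator (fun p => G (ofRealVec p)) p
  rw [hind, integral_neg_eq_self]

/-- [our object] **SYMMETRY OF THE SLICE-PROJECTOR COMPLEMENT**: `piC N x y = piC N y x`. -/
theorem piC_symm (x y : Fin (d + 1) → ℤ) : piC N x y = piC N y x := by
  have h : latticeKernel (fun k => S N (-y) (-x) k) 0 = latticeKernel (fun k => S N (-x) (-y) k) 0 := by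
    rw [← latticeKernel_reflect_zero (fun k => S N (-x) (-y) k)]
    exact latticeKernel_congr (fun p hp => (S_neg_swap N (ofRealVec_mem_Fat hp) (-x) (-y)).symm) 0
  unfold piC
  rw [h]

end Symm

/-! ## §10 REALITY: `conj (piC N x y) = piC N y x` (Hermiticity, conjugation route on the real zone), hence with §9 `piC N x y ∈ ℝ` -/

section Real

variable (N : ℕ) [NeZero N]

/-- [folklore] conjugation reflects the lattice argument of a character at a REAL momentum. -/
theorem conj_cphase_ofRealVec (a : Fin (d + 1) → ℤ) (q : Fin (d + 1) → ℝ) :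
    (starRingEnd ℂ) (cphase a (ofRealVec q)) = cphase (-a) (ofRealVec q) := by
  unfold cphase
  rw [← Complex.exp_conj, map_mul, Complex.conj_I, map_sum]
  congr 1
  rw [neg_mul, ← mul_neg, ← Finset.sum_neg_distrib]
  congr 1
  refine Finset.sum_congr rfl fun μ _ => ?_
  simp only [ofRealVec, map_mul, Complex.conj_ofReal, Pi.neg_apply, Int.cast_neg, ← Complex.ofReal_intCast, mul_neg]

/-- [folklore] `conj (gsum x M) = gsum (−x) M` for real `x`. -/
theorem conj_gsum_ofReal (x : ℝ) (M : ℕ) : (starRingEnd ℂ) (gsum (x : ℂ) M) = gsum (-(x : ℂ)) M := by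
  unfold gsum
  rw [map_sum]
  refine Finset.sum_congr rfl fun t _ => ?_
  rw [← Complex.exp_conj, map_mul, map_mul, Complex.conj_I, Complex.conj_ofReal, Complex.conj_natCast]
  ring_nf

omit [NeZero N] in
/-- [folklore] at a real momentum the alias momentum is real, coordinatewise. -/
theorem aliasPt_ofRealVec_apply (l : Fin (d + 1) → Fin N) (p : Fin (d + 1) → ℝ) (i : Fin (d + 1)) :
    aliasPt N l (ofRealVec p) i = ((GAN24.AliasTiling.apt N l p i : ℝ) : ℂ) := by
  rw [GAN24.AliasDecimate.aliasPt_ofRealVec]; rfl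

omit [NeZero N] in
/-- [folklore] `conj qa = qb` on the real zone. -/
theorem conj_qa_ofRealVec (l : Fin (d + 1) → Fin N) (p : Fin (d + 1) → ℝ) :
    (starRingEnd ℂ) (qa N l (ofRealVec p)) = qb N l (ofRealVec p) := by
  unfold qa qb
  rw [map_mul, map_inv₀, map_pow, Complex.conj_natCast, map_prod]
  congr 1
  refine Finset.prod_congr rfl fun i _ => ?_
  rw [aliasPt_ofRealVec_apply, conj_gsum_ofReal]

omit [NeZero N] in
/-- [folklore] `conj qb = qa` on the real zone. -/
theorem conj_qb_ofRealVec (l : Fin (d + 1) → Fin N) (p : Fin (d + 1) → ℝ) :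
    (starRingEnd ℂ) (qb N l (ofRealVec p)) = qa N l (ofRealVec p) := by
  have h := congrArg (starRingEnd ℂ) (conj_qa_ofRealVec N l p)
  rw [Complex.conj_conj] at h
  exact h.symm

/-- [folklore] the regrouping factor is real on the real zone. -/
theorem conj_ew_ofRealVec (l : Fin (d + 1) → Fin N) (p : Fin (d + 1) → ℝ) :
    (starRingEnd ℂ) (ew N l (ofRealVec p)) = ew N l (ofRealVec p) := by
  by_cases hl : l = fun _ => 0
  · subst hl; rw [ew_zero, map_one]
  · rw [ew_ne N hl, B4Strip.shift_ofReal, B4Strip.DeltaXi_ofReal, B4Strip.DeltaXi_ofReal, map_div₀, Complex.conj_ofReal,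
      Complex.conj_ofReal]

/-- [folklore] `conj Ra = Rb` on the real zone (same lattice argument). -/
theorem conj_Ra_ofRealVec (a : Fin (d + 1) → ℤ) (p : Fin (d + 1) → ℝ) :
    (starRingEnd ℂ) (Ra N a (ofRealVec p)) = Rb N a (ofRealVec p) := by
  unfold Ra Rb
  rw [map_sum]
  refine Finset.sum_congr rfl fun l _ => ?_
  rw [map_mul, map_mul, GAN24.AliasDecimate.aliasPt_ofRealVec, conj_cphase_ofRealVec, ← GAN24.AliasDecimate.aliasPt_ofRealVec,
    conj_qa_ofRealVec, conj_ew_ofRealVec]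

/-- [folklore] `conj Rb = Ra` on the real zone. -/
theorem conj_Rb_ofRealVec (b : Fin (d + 1) → ℤ) (p : Fin (d + 1) → ℝ) :
    (starRingEnd ℂ) (Rb N b (ofRealVec p)) = Ra N b (ofRealVec p) := by
  unfold Ra Rb
  rw [map_sum]
  refine Finset.sum_congr rfl fun l _ => ?_
  rw [map_mul, map_mul, GAN24.AliasDecimate.aliasPt_ofRealVec, conj_cphase_ofRealVec, ← GAN24.AliasDecimate.aliasPt_ofRealVec, neg_neg,
    conj_qb_ofRealVec, conj_ew_ofRealVec]

/-- [our object] **HERMITICITY AT THE SYMBOL LEVEL**: `conj (S N a b k) = S N b a k` at every REAL momentum. -/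
theorem conj_S_ofRealVec (a b : Fin (d + 1) → ℤ) (p : Fin (d + 1) → ℝ) :
    (starRingEnd ℂ) (S N a b (ofRealVec p)) = S N b a (ofRealVec p) := by
  rw [S_eq_Ra_mul_Rb, S_eq_Ra_mul_Rb, map_div₀, map_mul, conj_Ra_ofRealVec, conj_Rb_ofRealVec, B5Strip145.Ncal_ofReal,
    Complex.conj_ofReal]
  ring

/-- [folklore] conjugation of the lattice kernel at the origin conjugates the symbol: `conj (latticeKernel G 0) = latticeKernel (conj ∘ G) 0`. -/
theorem conj_latticeKernel_zero (G : (Fin (d + 1) → ℂ) → ℂ) :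
    (starRingEnd ℂ) (latticeKernel G 0) = latticeKernel (fun k => (starRingEnd ℂ) (G k)) 0 := by
  unfold latticeKernel fourierBox
  have hI : ∀ F : (Fin (d + 1) → ℂ) → ℂ, integrand F 0 = fun p => F (ofRealVec p) := by
    intro F; funext p; simp [integrand, phase]
  rw [hI, hI, Complex.real_smul, Complex.real_smul, map_mul, Complex.conj_ofReal, integral_conj]

/-- [our object] **HERMITICITY**: `conj (piC N x y) = piC N y x`. -/
theorem conj_piC (x y : Fin (d + 1) → ℤ) : (starRingEnd ℂ) (piC N x y) = piC N y x := by
  have h : latticeKernel (fun k => (starRingEnd ℂ) (S N (-y) (-x) k)) 0 = latticeKernel (fun k => S N (-x) (-y) k) 0 :=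
    latticeKernel_congr (fun p _ => conj_S_ofRealVec N (-y) (-x) p) 0
  unfold piC
  rw [map_mul, map_inv₀, map_pow, Complex.conj_natCast, conj_latticeKernel_zero, h]

/-- [our object] **REALITY**: `conj (piC N x y) = piC N x y` (Hermiticity ∘ symmetry). -/
theorem conj_piC_eq_self (x y : Fin (d + 1) → ℤ) : (starRingEnd ℂ) (piC N x y) = piC N x y := by
  rw [conj_piC, piC_symm]

/-- [our object] the imaginary part vanishes. -/
theorem piC_im (x y : Fin (d + 1) → ℤ) : (piC N x y).im = 0 :=
  Complex.conj_eq_iff_im.mp (conj_piC_eq_self N x y)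

/-- [our object] `piC` is its real part: `((piC N x y).re : ℂ) = piC N x y` — the road's real kernels may consume `(piC N x y).re`. -/
theorem ofReal_piC_re (x y : Fin (d + 1) → ℤ) : (((piC N x y).re : ℝ) : ℂ) = piC N x y :=
  Complex.conj_eq_iff_re.mp (conj_piC_eq_self N x y)

end Real

end Summit.QuantumFields.BalabanUV.Beta.FP.SliceProjectorKernelSymm

end
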